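import Summits.BirchSwinnertonDyer.Rank1Residual.X11b.CharacterSupply

set_option linter.dupNamespace false
set_option autoImplicit false

/-! # Route `CongruentShaFreeCut` (rung S2) — crux `AnalyticRankOneOfRankOneFiniteShaTwo`
(stmt-BirchSwinnertonDyer-19080), line `two-adic-bdp-triple` v5b: the anticyclotomic λ-SUPPLY at
EVERY prime `p` — in particular at `p = 2` — (plan g11 PORT NOTE
`routes-g11/kit/P2-CHARACTER-SUPPLY-PORT-NOTE.md`; first of two files, sequel
`CongruentShaFreeCutFrameRigidityAnyPrime.lean` = interpolation characters + frame rigidity at `p = 2`)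

Cell `bsd-cn100`, prover seat `bsd-cn100-s2-c3` (g5). Supports, does not close,
stmt-BirchSwinnertonDyer-19080. HONEST FRAMING: infrastructure only — nothing here proves crux B, the
leaf, (LB-exist)/(LB-wan)/(LB-bdp) or any case of BSD; no named fact, no `sorry`.

## Why

The v5b line of 19080 states (LB-wan) `TwoAdicWanDivisibility` and (LB-bdp) `TwoAdicBDPValueAtOne`
for EVERY element of the BDP frame `IsBDPLFunction ι' v κ γ Dt.f Ω_K Ω_p L` at `p = 2`. The frame is
certified non-vacuous and rigid (unique `L` at fixed periods) by the X11b cell's character supply —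
`X11b.lambdaSupplyAt` → `LambdaSupply.exists_interpolationCharacter` → `X11b.characterSupplyAt` →
`X11b.isBDPLFunction_unique` — which carries `p ≠ 2` at exactly two spots of
`LambdaSupply.exists_lambda_of_character` (PORT NOTE (O1) `eq_one_of_mul_self_eq_one`: no principal
unit of order two; (O2) the halving exponent `(p^s + 1)/2` of `PadicUnits.exists_twists`), both of
which only serve to keep the output character `λ` of infinity type EXACTLY `(1, −1)`. Every consumer
needs only SOME positive type `(m, −m)`. This file removes `p ≠ 2` by TYPE-RAISING.

## What is proved (every prime `p`, every imaginary quadratic `K`, every anticyclotomic `κ`)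

* `exists_lambda_of_character_pow` — from one algebraic Hecke character `Ψ` (unramified outside `p`,
  `Ψ/(Ψ∘c)` unitary of type `(1,−1)`) a pair `(λ, r_λ)` with `λ` unitary of infinity type
  `(T, −T)` for some `T > 0`, trivial on `𝕀_ℚ`, unramified outside `p`, `r_λ` its `p`-adic avatar
  FACTORING THROUGH `κ`. Proof: Weil's `p`-adic character `a` of `Ψ`; its Teichmüller part `ω`
  (`exists_teichmueller_splitting`, `p`-general) makes `h_a = a ω⁻¹` principal-unit-valued; the
  anti-invariant quotient `h = h_a/(h_a∘θ)` satisfies `h^{p^s} = 1` on `N = ker Φ₀ ∩ ker Φ₁`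
  (`pow_eq_one_of_forall_character` + `eq_one_of_pow_eq_one_of_coprime`); LEMMA Λ′
  (`mul_self_eq_one_of_anti`, `p`-general) gives `(h^{p^s})² = 1` on `ker κ`; so with `T = 2 p^s`
  the anti-invariant quotient `h^T` of `u = h_a^T` KILLS `ker κ` outright — no order-two analysis, no
  halving. Then `λ := Ψ′/(Ψ′∘c)` for `Ψ′ = (Ψ μ_ω)^T` exactly as in the odd-prime proof
  (`μ_ω` the finite-order Hecke character with avatar `ω`).
* `lambdaSupplyAt_pow` — the λ-supply: for every `ι' : ℚ̄_p ≃ ℂ`, imaginary quadratic `K` and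
  anticyclotomic `κ`, such a pair with SOME `T > 0` (at odd `p` this is `X11b.lambdaSupplyAt` with a
  larger type, harmless for all consumers).

References: [Weil1956] §1–§2; [Greenberg1987] §2; [Washington1997] §5.1, §13.1, Thm. 13.4. -/

noncomputable section

open scoped NumberField Classical Topology
open Filter NumberField IsDedekindDomain Field Polynomial PowerSeries
  Literature.NumberTheory.GaloisRepresentations Literature.NumberTheory.EllipticCurves
  Literature.NumberTheory.Automorphic
open Summit.BirchSwinnertonDyer.Rank1Residual.X11b
open Summit.BirchSwinnertonDyer.Rank1Residual.X11b.Three.LambdaSupply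
open Summit.BirchSwinnertonDyer.Rank1Residual.X11b.LambdaSupply
open Summit.BirchSwinnertonDyer.Rank1Residual.X11b.Halves

namespace Summit.BirchSwinnertonDyer.BirchSwinnertonDyer.Theorems.CongruentShaFreeCutLambdaSupplyAnyPrime

/-! ## §1 The anticyclotomic pair `(λ, r_λ)` at EVERY prime `p`, by type-raising -/

section Lambda

variable {K : Type} [Field K] [NumberField K] {p : ℕ} [Fact p.Prime]

/-- Unitarity is preserved by natural powers. [folklore] -/
theorem isUnitary_pow {χ : HeckeCharacter K} (hχ : χ.IsUnitary) (n : ℕ) : (χ ^ n).IsUnitary := by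
  induction n with
  | zero => rw [pow_zero]; exact HeckeCharacter.isUnitary_one
  | succ n ih => rw [pow_succ]; exact ih.mul hχ

/-- **The anticyclotomic pair `(λ, r_λ)` from one algebraic Hecke character `Ψ`, at EVERY prime `p`
(type-raised form of `LambdaSupply.exists_lambda_of_character`, no `p ≠ 2`).** For `K` imaginary
quadratic, `κ` anticyclotomic, `σ_c ≠ 1`, and `Ψ` algebraic, unramified outside `p`, with
`Ψ (Ψ∘σ_c)⁻¹` unitary of infinity type `(1, −1)`: there are `T > 0` and a pair `(λ, r_λ)` — `λ`
unitary of infinity type `(T, −T)`, trivial on `𝕀_ℚ`, unramified outside `p`, `r_λ` its `p`-adic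
avatar — with `r_λ` factoring through `κ`. See the module docstring for the proof (Teichmüller
splitting, `h^{p^s} = 1` on `N`, LEMMA Λ′ squared, `T = 2·p^s`).
[cite: Weil1956, §1–§2] [cite: Greenberg1987, §2] [cite: Washington1997, §13.1 and Thm. 13.4] -/
theorem exists_lambda_of_character_pow (ι : PadicAlgCl p ≃+* ℂ) (κ : ZpExtension K p)
    (hK : Module.finrank ℚ K = 2) (himag : ∀ w : InfinitePlace K, w.IsComplex)
    (hκ : κ.IsAnticyclotomic) {σc : K ≃ₐ[ℚ] K} (hσc : σc ≠ 1)
    {Ψ : HeckeCharacter K} (hΨa : Ψ.IsAlgebraic)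
    (hΨu : ∀ v : HeightOneSpectrum (𝓞 K), ((p : ℕ) : 𝓞 K) ∉ v.asIdeal → Ψ.IsUnramifiedAt v)
    (hunit : (Ψ * (HeckeCharacter.galConj σc Ψ)⁻¹).IsUnitary)
    (htype : (Ψ * (HeckeCharacter.galConj σc Ψ)⁻¹).HasInfinityType
      (fun _ ↦ (1 : ℤ)) (fun _ ↦ (-1 : ℤ))) :
    ∃ (T : ℕ) (lam : HeckeCharacter K) (rlam : FramedGaloisRep K (PadicAlgCl p) 1), 0 < T ∧
      lam.IsUnitary ∧ lam.HasInfinityType (fun _ ↦ (T : ℤ)) (fun _ ↦ (-(T : ℤ))) ∧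
      (∀ x : ideleGroup ℚ, lam (AdeleRing.ideleBaseChange ℚ K x) = 1) ∧
      (∀ v : HeightOneSpectrum (𝓞 K), ((p : ℕ) : 𝓞 K) ∉ v.asIdeal → lam.IsUnramifiedAt v) ∧
      IsPAdicAvatarOf ι lam rlam ∧ FactorsThroughZp κ rlam := by
  classical
  have hp : p.Prime := Fact.out
  haveI : Algebra.IsQuadraticExtension ℚ K := { finrank_eq_two' := hK }
  haveI : IsGalois ℚ K := inferInstance
  -- the currency `e : ℚ̄_pˣ ≃ GL₁(ℚ̄_p)`
  set e := (FramedRep.unitsContinuousMulEquivOfUnique (Fin 1) (PadicAlgCl p) :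
    (PadicAlgCl p)ˣ →ₜ* GL (Fin 1) (PadicAlgCl p)) with he
  -- Step 1: `c`, its lift `θ`, and the rank-two basis
  obtain ⟨c, hc, hc2⟩ := exists_not_mem_range_absGaloisRestrict (L := K) (Rat.castHom ℝ) himag
  have hinj := absGaloisRestrict_injective ℚ K
  have hidx : ∀ ρ ρ' : absoluteGaloisGroup ℚ, ρ ∉ Set.range (absGaloisRestrict ℚ K) →
      ρ' ∉ Set.range (absGaloisRestrict ℚ K) → ρ⁻¹ * ρ' ∈ Set.range (absGaloisRestrict ℚ K) :=
    fun ρ ρ' hρ hρ' => inv_mul_mem_range_absGaloisRestrict hK hρ hρ'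
  obtain ⟨θ, hθ⟩ := ZpExtension.IndexTwo.exists_conjHom (absGaloisRestrict ℚ K) hinj hidx c
  have hθθ : ∀ σ, θ (θ σ) = σ := ZpExtension.IndexTwo.conjHom_conjHom hinj hc2 hθ
  obtain ⟨Φ₀, Φ₁, hsurj, hspan⟩ := exists_spanningPair (p := p) hK himag
  -- Step 2: Weil's character of `Ψ` with values in a finite `E/ℚ_p`
  obtain ⟨E, hEfd, a, ha, haΨ⟩ := exists_weilValued ι hΨa
  haveI : CompleteSpace E := FiniteDimensional.complete ℚ_[p] E
  set ιE : (E)ˣ →* (PadicAlgCl p)ˣ :=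
    Units.map ((algebraMap E (PadicAlgCl p) : E →+* PadicAlgCl p) : E →* PadicAlgCl p) with hιE
  have hιE_inj : Function.Injective ιE := fun x y hxy =>
    Units.ext (Subtype.ext (congrArg Units.val hxy))
  -- its currency `ψa` and the avatar `e ∘ ψa⁻¹` of `Ψ`
  obtain ⟨ψa, hψa⟩ := exists_unitsChar_of_continuous (p := p) a ha
  have hψa' : ∀ σ, ψa σ = ιE (a σ) := fun σ => Units.ext (hψa σ)
  have hΨav : IsPAdicAvatarOf ι Ψ (e.comp ψa⁻¹) := by
    rw [isPAdicAvatarOf_unitsChar_iff]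
    intro v hv hu
    obtain ⟨h1, h2⟩ := haΨ v hv hu
    refine ⟨fun 𝔓 h𝔓 σ hσ => ?_, fun 𝔓 h𝔓 Φ hΦ => ?_⟩
    · rw [unitsChar_inv_apply, hψa', h1 𝔓 h𝔓 σ hσ, map_one, inv_one]
    · rw [unitsChar_inv_apply, Units.val_inv_eq_inv_val, hψa, h2 𝔓 h𝔓 Φ hΦ]
  -- Step 3: the set `S` (inertia at `v ∤ p`), killed by `a`
  set S : Set (absoluteGaloisGroup K) := {σ | ∃ v : HeightOneSpectrum (𝓞 K),
    ((p : ℕ) : 𝓞 K) ∉ v.asIdeal ∧ ∃ 𝔓 ∈ v.primesAbove,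
      σ ∈ 𝔓.inertia (absoluteGaloisGroup K)} with hS
  have haS : ∀ σ ∈ S, a σ = 1 := by
    rintro σ ⟨v, hv, 𝔓, h𝔓, h⟩
    exact (haΨ v hv (hΨu v hv)).1 𝔓 h𝔓 σ h
  -- Step 4: the Teichmüller part `ω` of `a`; `h_a = a ω⁻¹` is principal-unit-valued
  obtain ⟨P, hP⟩ := PadicUnits.exists_principalUnits (F := E)
  have hPmul : ∀ {x y : (E)ˣ}, x ∈ P → y ∈ P → x * y ∈ P := fun hx hy => P.mul_mem hx hy
  have hPinv : ∀ {x : (E)ˣ}, x ∈ P → x⁻¹ ∈ P := fun hx => P.inv_mem hx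
  obtain ⟨T₀, hT₀, hT₀p, haT⟩ :=
    LambdaSupply.PadicUnits.exists_pow_mem_principalUnits_coprime (p := p) a ha P hP
  obtain ⟨ω, -, haω, hωP⟩ :=
    PadicUnits.exists_teichmueller_splitting (p := p) a P hP hT₀ hT₀p haT
  have hωS : ∀ σ ∈ S, ω σ = 1 := fun σ hσ => hωP σ (by rw [haS σ hσ]; exact P.one_mem)
  have hωker : IsOpen (ω.ker : Set (absoluteGaloisGroup K)) := by
    have hPo : IsOpen (P : Set (E)ˣ) := by
      have : (P : Set (E)ˣ) = {u : (E)ˣ | ‖1 - (u : E)‖ < 1} := Set.ext fun u => hP u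
      rw [this]; exact PadicUnits.isOpen_setOf_norm_one_sub_lt
    exact Subgroup.isOpen_mono (H₁ := P.comap a) (fun σ hσ => hωP σ hσ) (hPo.preimage ha)
  have hωc : Continuous ω := PadicUnits.continuous_of_isOpen_ker' ω hωker
  set hA : absoluteGaloisGroup K →* (E)ˣ := a * ω⁻¹ with hhA
  have hhA_apply : ∀ σ, hA σ = a σ * (ω σ)⁻¹ := fun σ => rfl
  have hhA_P : ∀ σ, hA σ ∈ P := fun σ => haω σ
  have hhA_c : Continuous hA := by
    show Continuous fun σ => (a * ω⁻¹) σ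
    simp only [MonoidHom.mul_apply, MonoidHom.inv_apply]
    exact ha.mul hωc.inv
  -- the anti-invariant quotient `h = h_a / (h_a ∘ θ)`
  set h : absoluteGaloisGroup K →* (E)ˣ := hA * (hA.comp θ.toMonoidHom)⁻¹ with hh
  have hh_apply : ∀ σ, h σ = hA σ * (hA (θ σ))⁻¹ := fun σ => rfl
  have hh_P : ∀ σ, h σ ∈ P := fun σ => hPmul (hhA_P σ) (hPinv (hhA_P _))
  have hh_c : Continuous h := by
    show Continuous fun σ => h σ
    simp only [hh_apply]
    exact hhA_c.mul (hhA_c.comp θ.continuous).inv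
  have hh_anti : ∀ σ, h (θ σ) = (h σ)⁻¹ := fun σ => by
    rw [hh_apply, hh_apply, hθθ, mul_inv_rev, inv_inv]
  -- Step 5: `h^{p^s}` kills `N = ker Φ₀ ∩ ker Φ₁`
  obtain ⟨M, hM, hMN⟩ :=
    PadicUnits.pow_eq_one_of_forall_character (p := p) (F := E) Φ₀ Φ₁ hspan h hh_c
  obtain ⟨s, m, hmp, rfl⟩ := Nat.exists_eq_pow_mul_and_not_dvd hM.ne' p hp.ne_one
  have hm : p.Coprime m := (Nat.Prime.coprime_iff_not_dvd hp).mpr hmp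
  have hsN : ∀ σ, Φ₀ σ = 1 → Φ₁ σ = 1 → (h σ) ^ p ^ s = 1 := by
    intro σ h0 h1
    have hy : ‖1 - (((h σ) ^ p ^ s : (E)ˣ) : E)‖ < 1 := (hP _).mp (P.pow_mem (hh_P σ) _)
    have hym : ((((h σ) ^ p ^ s : (E)ˣ) : E)) ^ m = 1 := by
      rw [← Units.val_pow_eq_pow_val, ← pow_mul, hMN σ h0 h1, Units.val_one]
    exact Units.ext (PadicUnits.eq_one_of_pow_eq_one_of_coprime (p := p) hy hm hym)
  -- `g₀ = h^{p^s}` is anti-invariant and kills `N`, so `g₀² = 1` on `ker κ` (LEMMA Λ′)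
  set g₀ : absoluteGaloisGroup K →* (E)ˣ := (powMonoidHom (p ^ s)).comp h with hg₀
  have hg₀_apply : ∀ σ, g₀ σ = (h σ) ^ p ^ s := fun σ => rfl
  have hg₀N : ∀ σ, Φ₀ σ = 1 → Φ₁ σ = 1 → g₀ σ = 1 := fun σ h0 h1 => by rw [hg₀_apply, hsN σ h0 h1]
  have hg₀anti : ∀ σ, g₀ (θ σ) = (g₀ σ)⁻¹ := fun σ => by rw [hg₀_apply, hg₀_apply, hh_anti, inv_pow]
  have hg₀κ : ∀ σ, κ σ = 1 → g₀ σ * g₀ σ = 1 := fun σ hσ =>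
    mul_self_eq_one_of_anti hK κ hκ hc hc2 hθ hsurj hspan g₀ hg₀N hg₀anti hσ
  -- the exponent `T = 2 p^s` and `u = h_a^T`, whose anti-invariant quotient is `h^T = g₀²`
  set T : ℕ := p ^ s * 2 with hTdef
  have hT : 0 < T := Nat.mul_pos (pow_pos hp.pos s) two_pos
  set u : absoluteGaloisGroup K →* (E)ˣ := (powMonoidHom T).comp hA with hu
  have hu_apply : ∀ σ, u σ = (hA σ) ^ T := fun σ => rfl
  have hquot : ∀ σ, u σ * (u (θ σ))⁻¹ = g₀ σ * g₀ σ := fun σ => by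
    rw [hu_apply, hu_apply, hg₀_apply, hh_apply, ← inv_pow, ← mul_pow, hTdef, pow_mul, pow_two]
  have hgκ : ∀ σ, κ σ = 1 → u σ * (u (θ σ))⁻¹ = 1 := fun σ hσ => by rw [hquot, hg₀κ σ hσ]
  -- Step 6: the finite-order Hecke character `μ_ω`
  obtain ⟨ψω, hψω⟩ := exists_unitsChar_of_continuous (p := p) ω hωc
  have hψω' : ∀ σ, ψω σ = ιE (ω σ) := fun σ => Units.ext (hψω σ)
  have hkω : IsOpen (ψω.toMonoidHom.ker : Set (absoluteGaloisGroup K)) := by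
    convert hωker using 1
    ext σ
    simp only [SetLike.mem_coe, MonoidHom.mem_ker]
    exact unitsChar_eq_one_iff hψω σ
  obtain ⟨μω, hμω_fin, hμω_av, hμω_unr⟩ := exists_hecke_of_isOpen_ker ι ψω.toMonoidHom hkω
  have hμω_av' : IsPAdicAvatarOf ι μω (e.comp ψω) :=
    (isPAdicAvatarOf_unitsChar_iff ι μω ψω).mpr hμω_av
  have hμω_u : ∀ v : HeightOneSpectrum (𝓞 K), ((p : ℕ) : 𝓞 K) ∉ v.asIdeal →
      μω.IsUnramifiedAt v :=
    fun v hv => hμω_unr v fun 𝔓 h𝔓 σ hσ =>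
      (unitsChar_eq_one_iff hψω σ).mpr (hωS σ ⟨v, hv, 𝔓, h𝔓, hσ⟩)
  -- Step 7: `Ψ₁ = Ψ μ_ω` with avatar `e ∘ ψ₁`, `ψ₁ = ψa⁻¹ ψω = ι_E ∘ h_a⁻¹`; then `Ψ′ = Ψ₁^T`
  set Ψ₁ : HeckeCharacter K := Ψ * μω with hΨ₁
  set ψ₁ : absoluteGaloisGroup K →ₜ* (PadicAlgCl p)ˣ := ψa⁻¹ * ψω with hψ₁def
  have hΨ₁u : ∀ v : HeightOneSpectrum (𝓞 K), ((p : ℕ) : 𝓞 K) ∉ v.asIdeal →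
      Ψ₁.IsUnramifiedAt v :=
    fun v hv => (hΨu v hv).mul' (hμω_u v hv)
  have hΨ₁av : IsPAdicAvatarOf ι Ψ₁ (e.comp ψ₁) :=
    isPAdicAvatarOf_mul ι hΨav hμω_av' (hram_of_forall hΨu hμω_u)
  have hψ₁_apply : ∀ τ, ψ₁ τ = ιE (hA τ)⁻¹ := fun τ => by
    show (ψa τ)⁻¹ * ψω τ = ιE (a τ * (ω τ)⁻¹)⁻¹
    rw [hψa', hψω', ← map_inv ιE, ← map_mul ιE]
    congr 1
    rw [mul_inv_rev, inv_inv, mul_comm]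
  set Ψ' : HeckeCharacter K := Ψ₁ ^ T with hΨ'
  set ψ' : absoluteGaloisGroup K →ₜ* (PadicAlgCl p)ˣ := ψ₁ ^ T with hψ'def
  have hΨ'u : ∀ v : HeightOneSpectrum (𝓞 K), ((p : ℕ) : 𝓞 K) ∉ v.asIdeal →
      Ψ'.IsUnramifiedAt v :=
    fun v hv => isUnramifiedAt_pow' (hΨ₁u v hv) T
  have hΨ'av : IsPAdicAvatarOf ι Ψ' (e.comp ψ') := isPAdicAvatarOf_pow ι hΨ₁av hΨ₁u T
  have hψ'_apply : ∀ τ, ψ' τ = ιE (u τ)⁻¹ := fun τ => by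
    show (ψ₁ ^ T) τ = ιE ((hA τ) ^ T)⁻¹
    rw [ContinuousMonoidHom.pow_apply, hψ₁_apply, ← map_pow, inv_pow]
  -- Step 8: `λ := Ψ′ (Ψ′ ∘ σ_c)⁻¹`, `r_λ := e ∘ (ψ′ (ψ′∘θ)⁻¹)`
  refine ⟨T, Ψ' * (HeckeCharacter.galConj σc Ψ')⁻¹, e.comp (ψ' * (ψ'.comp θ)⁻¹), hT, ?_, ?_,
    fun x => mul_galConj_inv_ideleBaseChange σc Ψ' x,
    fun v hv => isUnramifiedAt_mul_galConj_inv_of_forall (p := p) σc hΨ'u v hv,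
    isPAdicAvatarOf_mul_galConj_inv_of_finrank_eq_two hK ι hΨ'av hΨ'u hc hθ hσc, ?_⟩
  -- unitarity: `λ = (Ψ (Ψ∘c)⁻¹)^T · ((μ (μ∘c)⁻¹))^T`, `μ = μ_ω` of finite order
  · have heq : Ψ' * (HeckeCharacter.galConj σc Ψ')⁻¹ = (Ψ * (HeckeCharacter.galConj σc Ψ)⁻¹) ^ T *
        (μω * (HeckeCharacter.galConj σc μω)⁻¹) ^ T := by
      rw [hΨ', hΨ₁, galConj_pow, ← inv_pow, ← mul_pow, HeckeCharacter.galConj_mul, mul_inv,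
        mul_mul_mul_comm, mul_pow]
    rw [heq]
    exact (isUnitary_pow hunit T).mul
      (isUnitary_pow (hμω_fin.isUnitary.mul (isUnitary_galConj σc hμω_fin.isUnitary).inv) T)
  -- infinity type `(T, −T)`
  · have heq : Ψ' * (HeckeCharacter.galConj σc Ψ')⁻¹ = (Ψ * (HeckeCharacter.galConj σc Ψ)⁻¹) ^ T *
        (μω * (HeckeCharacter.galConj σc μω)⁻¹) ^ T := by
      rw [hΨ', hΨ₁, galConj_pow, ← inv_pow, ← mul_pow, HeckeCharacter.galConj_mul, mul_inv,
        mul_mul_mul_comm, mul_pow]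
    rw [heq]
    have h0 := (hasInfinityType_zero_of_isFiniteOrder hμω_fin).mul'
      (hasInfinityType_zero_of_isFiniteOrder (isFiniteOrder_galConj σc hμω_fin)).inv
    have h1 := (HasInfinityType.pow_nat htype T).mul' (HasInfinityType.pow_nat h0 T)
    convert h1 using 2 <;> simp
  -- factorisation through `κ`: `ψ′ (ψ′∘θ)⁻¹ = ι_E ∘ (u/(u∘θ))⁻¹`
  · rw [factorsThroughZp_unitsChar_iff]
    intro σ hσ
    rw [ContinuousMonoidHom.mul_apply, unitsChar_inv_apply, ContinuousMonoidHom.coe_comp,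
      Function.comp_apply, hψ'_apply, hψ'_apply, ← map_inv ιE, inv_inv, ← map_mul ιE,
      show (u σ)⁻¹ * u (θ σ) = (u σ * (u (θ σ))⁻¹)⁻¹ by rw [mul_inv_rev, inv_inv, mul_comm],
      hgκ σ hσ, inv_one, map_one]

end Lambda

/-! ## §2 The λ-supply at EVERY prime `p` (type `(T, −T)` for some `T > 0`) -/

section Supply

variable {K : Type} [Field K] [NumberField K] {p : ℕ} [Fact p.Prime]

/-- **The λ-SUPPLY at every prime `p`, UNCONDITIONAL** (`X11b.lambdaSupplyAt` without `p ≠ 2`, at the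
price of an infinity type `(T, −T)`, `T > 0`, instead of `(1, −1)`): for every `ι' : ℚ̄_p ≃ ℂ`, every
imaginary quadratic `K` and every anticyclotomic `ℤ_p`-extension `κ` of `K` there are `T > 0` and a
pair `(λ, r_λ)` — `λ` unitary of infinity type `(T, −T)`, trivial on `𝕀_ℚ`, unramified outside `p`,
`r_λ` its `p`-adic avatar — with `r_λ` factoring through `κ`. Proof: `exists_lambda_of_character_pow`
with part (A)'s `Ψ` (`Three.LambdaSupply.exists_character_quotient_type_one`, `2 ≤ p`).
[cite: Weil1956, §1–§2] [cite: Greenberg1987, §2] [cite: Washington1997, §13.1] -/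
theorem lambdaSupplyAt_pow (ι' : PadicAlgCl p ≃+* ℂ) (K : Type) [Field K] [NumberField K]
    (κ : ZpExtension K p) (hK : IsImaginaryQuadratic K) (hκ : κ.IsAnticyclotomic) :
    ∃ (T : ℕ) (lam : HeckeCharacter K) (rlam : FramedGaloisRep K (PadicAlgCl p) 1), 0 < T ∧
      lam.IsUnitary ∧ lam.HasInfinityType (fun _ ↦ (T : ℤ)) (fun _ ↦ (-(T : ℤ))) ∧
      (∀ x : ideleGroup ℚ, lam (AdeleRing.ideleBaseChange ℚ K x) = 1) ∧
      (∀ v : HeightOneSpectrum (𝓞 K), ((p : ℕ) : 𝓞 K) ∉ v.asIdeal → lam.IsUnramifiedAt v) ∧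
      IsPAdicAvatarOf ι' lam rlam ∧ FactorsThroughZp κ rlam := by
  haveI : IsTotallyComplex K := hK.2
  haveI : Algebra.IsQuadraticExtension ℚ K := { finrank_eq_two' := hK.1 }
  haveI : IsCMField K := IsCMField.ofCMExtension ℚ K
  obtain ⟨Ψ, hΨa, hΨu, hunit, htype⟩ :=
    exists_character_quotient_type_one (K := K) hK.1 (p := p) (Fact.out : p.Prime).two_le
  exact exists_lambda_of_character_pow ι' κ hK.1 IsTotallyComplex.isComplex hκ
    restrictScalars_complexConj_ne_one hΨa hΨu hunit htype

end Supply

end Summit.BirchSwinnertonDyer.BirchSwinnertonDyer.Theorems.CongruentShaFreeCutLambdaSupplyAnyPrime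

end
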